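import Summits.AtomisticToContinuum.HydrodynamicLimit.Theorems.ImplosionDichotomyPolynomialCompressionStaticsSmoothRate

/-!
# Second-order asymptotics of the limit insertion ratio of the canonical hard-sphere gas

Helper file for the stub `stub_tiedStatics` (line `kidder-knob-melnikov`) of the crux
`Summit.AtomisticToContinuum.HydrodynamicLimit.Theses.ImplosionDichotomy.DenseExcursion`
(stmt-AtomisticToContinuum-12586): the SCALAR part of the second-order low-density statics.

With `γ_{j+1} = clusterCoeff σ j = σ^{3j} b_j / j!` (`HardSphereCanonicalTorus`), `m_k = ∫ βᵏ`,
`R = ratioLimit P σ` the root of `R F(R) = 1`, `F(R) = ∑_j γ_{j+1} m_{j+1} Rʲ` (`HardSphereEulerRatio`)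
and `θ = geomRatio P σ = 2eMv₁σ³ = K σ³` (`geomRatio_eq`):
* `v₁_eq`, `cE_one`, `bE_one(_eq)`: the first cluster constant is the Mayer bond integral
  `b₁ = -v₁ = -4π/3` (`hcUrsell_pair`, Mathlib `EuclideanSpace.volume_ball_fin_three`);
* `abs_ratioSeries_sub_le`: `|F(R) - (1 + γ₂ m₂ R + γ₃ m₃ R²)| ≤ 2eθ³`
  (tail bound `|γ_{j+1} m_{j+1} Rʲ| ≤ eθʲ`, `θ ≤ 1/2`);
* `abs_fixedPoint_le`: `|R - 1 + γ₂ m₂ R² + γ₃ m₃ R³| ≤ 4eθ³` (`R F(R) = 1`, `R ≤ 2`);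
* `abs_sub_first_le`, `abs_sq_sub_first_le`, `abs_sub_second_le`, `abs_cube_sub_one_le'`:
  `R = 1 + R₁σ³ + O(σ⁶)`, `R² = 1 + 2R₁σ³ + O(σ⁶)`, **`R = 1 + R₁σ³ + R₂σ⁶ + O(σ⁹)`**,
  `R³ = 1 + O(σ³)` with `R₁ = -b₁ m₂`, `R₂ = 2R₁² - (b₂/2) m₃`, uniformly under `SmallDensity P σ`
  (the coefficients are written out; no auxiliary definitions).

Orientation: E. Pulvirenti, D. Tsagkarogiannis, Comm. Math. Phys. 316 (2012) §3–5 (canonical cluster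
expansion); J. L. Lebowitz, O. Penrose, J. Math. Phys. 5 (1964) 841 (virial expansion of hard spheres).
-/

noncomputable section

namespace Summit.AtomisticToContinuum.HydrodynamicLimit.Theorems.TiedStaticsRatio

open MeasureTheory Set Filter Topology Finset
open Literature.MathematicalPhysics.KineticTheory
open Literature.Analysis.FunctionSpaces
open Literature.MathematicalPhysics.StatisticalMechanics
open Literature.Probability.LatticeModels

/-! ## The first cluster constant: `b₁ = -v₁ = -4π/3` -/

/-- The volume of the unit ball of `ℝ³` is `4π/3`. [folklore] -/
theorem v₁_eq : v₁ = 4 * Real.pi / 3 := by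
  unfold v₁
  rw [EuclideanSpace.volume_ball_fin_three, ENNReal.ofReal_one, one_pow, one_mul,
    ENNReal.toReal_ofReal (by positivity)]
  ring

/-- The Ursell function of two unit-diameter spheres, one pinned at the origin, is minus the overlap
indicator (the Mayer bond). [folklore] -/
theorem cE_one (z : Fin 1 → E3) : cE 1 z = -(if ‖z 0‖ < 1 then 1 else 0) := by
  unfold cE uR
  rw [Finset.univ_fin2, hcUrsell_pair (overlapRel_symm (ovE_symm 1) _) (by decide)]
  simp only [overlapRel, OvE, ne_eq, zero_ne_one, not_false_eq_true, true_and, Fin.cons_zero,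
    Fin.cons_one, zero_sub, norm_neg]
  push_cast
  split_ifs <;> simp

/-- **The first cluster constant** `b₁ = ∫ c₁(0, z) dz = -v₁`. [folklore] -/
theorem bE_one : bE 1 = -v₁ := by
  classical
  unfold bE
  have hfun : (fun z : Fin 1 → E3 => cE 1 z) =
      fun z => -((Metric.ball (0 : E3) 1).indicator (fun _ => (1 : ℝ))
        (MeasurableEquiv.funUnique (Fin 1) E3 z)) := by
    funext z
    rw [cE_one, Set.indicator_apply, Metric.mem_ball, dist_zero_right]
    rfl
  have h := (volume_preserving_funUnique (Fin 1) E3).integral_comp'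
    (fun y : E3 => (Metric.ball (0 : E3) 1).indicator (fun _ => (1 : ℝ)) y)
  rw [hfun, integral_neg]
  erw [h]
  rw [integral_indicator_const _ measurableSet_ball, smul_eq_mul, mul_one, v₁, Measure.real]

/-- `b₁ = -4π/3`. [folklore] -/
theorem bE_one_eq : bE 1 = -(4 * Real.pi / 3) := by rw [bE_one, v₁_eq]

/-- `γ₂ = σ³ b₁`. [folklore] -/
theorem clusterCoeff_one (σ : ℝ) : clusterCoeff σ 1 = σ ^ 3 * bE 1 := by
  simp [clusterCoeff]

/-- `γ₃ = σ⁶ b₂ / 2`. [folklore] -/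
theorem clusterCoeff_two (σ : ℝ) : clusterCoeff σ 2 = σ ^ 6 / 2 * bE 2 := by
  rw [clusterCoeff, Nat.factorial_two]
  push_cast
  ring

/-- The coefficients of `F`: `coefLim P σ 1 j = γ_{j+1} ∫ β^{j+1}`. [folklore] -/
theorem coefLim_one (P : DensityProfile) (σ : ℝ) (j : ℕ) :
    coefLim P σ (fun _ => 1) j = clusterCoeff σ j * ∫ y, P.β y ^ (j + 1) := by
  simp [coefLim]

/-! ## Second-order asymptotics of the limit insertion ratio `R(σ)`

The Taylor coefficients `R₁ = -b₁ ∫ β²`, `R₂ = 2 R₁² - (b₂/2) ∫ β³` of `R(σ)` in `σ³` and the constant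
`K = 2 e M v₁` of `θ = K σ³` are written out in the statements (no auxiliary definitions). -/

variable {P : DensityProfile} {σ : ℝ}

/-- `θ = 2 e M v₁ σ³`. [folklore] -/
theorem geomRatio_eq (P : DensityProfile) (σ : ℝ) :
    geomRatio P σ = 2 * Real.exp 1 * P.M * v₁ * σ ^ 3 := by
  rw [geomRatio, ovDensity]; ring

/-- `|R² - 1| ≤ 12 e θ`. [folklore] -/
theorem abs_sq_sub_one_le (h : SmallDensity P σ) :
    |ratioLimit P σ ^ 2 - 1| ≤ 12 * Real.exp 1 * geomRatio P σ := by
  have h1 := StaticsSmoothRate.abs_ratioLimit_sub_one_le h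
  have hR0 := h.ratioLimit_pos
  have hR2 := h.ratioLimit_mem.2
  have hθ0 := h.geomRatio_nonneg
  have e : ratioLimit P σ ^ 2 - 1 = (ratioLimit P σ - 1) * (ratioLimit P σ + 1) := by ring
  rw [e, abs_mul, abs_of_pos (by linarith : 0 < ratioLimit P σ + 1)]
  calc |ratioLimit P σ - 1| * (ratioLimit P σ + 1) ≤ (4 * Real.exp 1 * geomRatio P σ) * 3 :=
        mul_le_mul h1 (by linarith) (by linarith) (by positivity)
    _ = 12 * Real.exp 1 * geomRatio P σ := by ring

/-- `|R³ - 1| ≤ 28 e θ`. [folklore] -/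
theorem abs_cube_sub_one_le (h : SmallDensity P σ) :
    |ratioLimit P σ ^ 3 - 1| ≤ 28 * Real.exp 1 * geomRatio P σ := by
  have h1 := StaticsSmoothRate.abs_ratioLimit_sub_one_le h
  have hR0 := h.ratioLimit_pos
  have hR2 := h.ratioLimit_mem.2
  have hθ0 := h.geomRatio_nonneg
  have e : ratioLimit P σ ^ 3 - 1 =
      (ratioLimit P σ - 1) * (ratioLimit P σ ^ 2 + ratioLimit P σ + 1) := by ring
  have hq : ratioLimit P σ ^ 2 + ratioLimit P σ + 1 ≤ 7 := by nlinarith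
  rw [e, abs_mul, abs_of_pos (by positivity : 0 < ratioLimit P σ ^ 2 + ratioLimit P σ + 1)]
  calc |ratioLimit P σ - 1| * (ratioLimit P σ ^ 2 + ratioLimit P σ + 1)
      ≤ (4 * Real.exp 1 * geomRatio P σ) * 7 := mul_le_mul h1 hq (by positivity) (by positivity)
    _ = 28 * Real.exp 1 * geomRatio P σ := by ring

/-- **The limit equation to second order**: `|F(R) - (1 + γ₂ m₂ R + γ₃ m₃ R²)| ≤ 2 e θ³` (the tail
`j ≥ 3` of `F(R) = ∑ γ_{j+1} m_{j+1} Rʲ`, `|γ_{j+1} m_{j+1} Rʲ| ≤ e θʲ`, `1 - θ ≥ 1/2`). [folklore] -/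
theorem abs_ratioSeries_sub_le (h : SmallDensity P σ) :
    |ratioSeries P σ (ratioLimit P σ) - (1 + clusterCoeff σ 1 * (∫ y, P.β y ^ 2) * ratioLimit P σ +
        clusterCoeff σ 2 * (∫ y, P.β y ^ 3) * ratioLimit P σ ^ 2)| ≤
      2 * Real.exp 1 * geomRatio P σ ^ 3 := by
  have hθ0 := h.geomRatio_nonneg
  have hθ1 := h.geomRatio_lt_one
  have hθ2 := StaticsSmoothRate.geomRatio_le_half h
  set R := ratioLimit P σ
  set f : ℕ → ℝ := fun j => coefLim P σ (fun _ => 1) j * R ^ j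
  have hs : Summable f := summable_ratioSeries h.σ_pos h.σ_lt_half hθ1 h.abs_ratioLimit_le
  have hsplit : (∑ i ∈ Finset.range 3, f i) + ∑' i, f (i + 3) = ratioSeries P σ R :=
    hs.sum_add_tsum_nat_add 3
  have h0 : f 0 = 1 := by
    show coefLim P σ (fun _ => 1) 0 * R ^ 0 = 1
    rw [coefLim_one_zero h.σ_pos]; ring
  have h1 : f 1 = clusterCoeff σ 1 * (∫ y, P.β y ^ 2) * R := by
    show coefLim P σ (fun _ => 1) 1 * R ^ 1 = _
    rw [coefLim_one, pow_one]
  have h2 : f 2 = clusterCoeff σ 2 * (∫ y, P.β y ^ 3) * R ^ 2 := by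
    show coefLim P σ (fun _ => 1) 2 * R ^ 2 = _
    rw [coefLim_one]
  have heq : ratioSeries P σ R - (1 + clusterCoeff σ 1 * (∫ y, P.β y ^ 2) * R +
      clusterCoeff σ 2 * (∫ y, P.β y ^ 3) * R ^ 2) = ∑' i, f (i + 3) := by
    rw [← hsplit, Finset.sum_range_succ, Finset.sum_range_succ, Finset.sum_range_one, h0, h1, h2]
    ring
  rw [heq]
  have hgeo : HasSum (fun j : ℕ => Real.exp 1 * geomRatio P σ ^ (j + 3))
      (Real.exp 1 * geomRatio P σ ^ 3 / (1 - geomRatio P σ)) := by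
    have h' := (hasSum_geometric_of_lt_one hθ0 hθ1).mul_left (Real.exp 1 * geomRatio P σ ^ 3)
    rw [div_eq_mul_inv]
    refine h'.congr_fun fun j => ?_
    ring
  have htail : ‖∑' i, f (i + 3)‖ ≤ Real.exp 1 * geomRatio P σ ^ 3 / (1 - geomRatio P σ) :=
    tsum_of_norm_bounded hgeo fun j => (Real.norm_eq_abs _).trans_le
      (abs_coefLim_one_mul_pow_le h.σ_pos h.σ_lt_half h.abs_ratioLimit_le (j + 3))
  rw [Real.norm_eq_abs] at htail
  refine htail.trans ?_
  rw [div_le_iff₀ (by linarith)]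
  have : 0 ≤ Real.exp 1 * geomRatio P σ ^ 3 := by positivity
  nlinarith

/-- **The fixed-point equation to second order**: `|R - 1 + γ₂ m₂ R² + γ₃ m₃ R³| ≤ 4 e θ³`
(multiply the previous estimate by `R ≤ 2` and use `R F(R) = 1`). [folklore] -/
theorem abs_fixedPoint_le (h : SmallDensity P σ) :
    |ratioLimit P σ - 1 + clusterCoeff σ 1 * (∫ y, P.β y ^ 2) * ratioLimit P σ ^ 2 +
        clusterCoeff σ 2 * (∫ y, P.β y ^ 3) * ratioLimit P σ ^ 3| ≤
      4 * Real.exp 1 * geomRatio P σ ^ 3 := by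
  have hspec := (ratioLimit_spec (P := P) h.σ_pos h.σ_lt_half h.geomRatio_lt_one h.phi_lt_half).2
  have hF := abs_ratioSeries_sub_le h
  have hR0 := h.ratioLimit_pos
  have hR2 := h.ratioLimit_mem.2
  have hθ0 := h.geomRatio_nonneg
  have heq : ratioLimit P σ - 1 + clusterCoeff σ 1 * (∫ y, P.β y ^ 2) * ratioLimit P σ ^ 2 +
      clusterCoeff σ 2 * (∫ y, P.β y ^ 3) * ratioLimit P σ ^ 3 =
      ratioLimit P σ * ((1 + clusterCoeff σ 1 * (∫ y, P.β y ^ 2) * ratioLimit P σ +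
        clusterCoeff σ 2 * (∫ y, P.β y ^ 3) * ratioLimit P σ ^ 2) -
          ratioSeries P σ (ratioLimit P σ)) := by
    rw [mul_sub, hspec]; ring
  rw [heq, abs_mul, abs_of_pos hR0, abs_sub_comm]
  calc ratioLimit P σ * _ ≤ 2 * (2 * Real.exp 1 * geomRatio P σ ^ 3) :=
        mul_le_mul hR2 hF (abs_nonneg _) zero_le_two
    _ = 4 * Real.exp 1 * geomRatio P σ ^ 3 := by ring

/-- `0 < K = 2 e M v₁` (the constant of `θ = K σ³`, `geomRatio_eq`). [folklore] -/
theorem K_pos (P : DensityProfile) : 0 < 2 * Real.exp 1 * P.M * v₁ := by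
  have := P.M_pos; have := v₁_pos; positivity

/-- `σ³ ≤ 1` under `SmallDensity`. [folklore] -/
theorem pow_three_le_one (h : SmallDensity P σ) : σ ^ 3 ≤ 1 :=
  pow_le_one₀ h.σ_pos.le (by linarith [h.σ_lt_half])

/-- The moments `∫ βᵏ` are nonnegative. [folklore] -/
theorem moment_nonneg (P : DensityProfile) (k : ℕ) : 0 ≤ ∫ y, P.β y ^ k :=
  integral_nonneg fun y => by have := P.pos y; positivity

/-- `R³ = 1 + O(σ³)` uniformly under `SmallDensity P σ`. [folklore] -/
theorem abs_cube_sub_one_le' (P : DensityProfile) :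
    ∃ C : ℝ, ∀ σ : ℝ, SmallDensity P σ → |ratioLimit P σ ^ 3 - 1| ≤ C * σ ^ 3 := by
  refine ⟨28 * Real.exp 1 * (2 * Real.exp 1 * P.M * v₁), fun σ h => ?_⟩
  have h1 := abs_cube_sub_one_le h
  rw [geomRatio_eq] at h1
  linarith

/-- `R = 1 + R₁ σ³ + O(σ⁶)`, `R₁ = -b₁ ∫ β²`, uniformly under `SmallDensity P σ`: from the fixed-point
estimate, `γ₂ = σ³ b₁`, `γ₃ = σ⁶ b₂/2`, `|R² - 1| ≤ 12eθ`, `R³ ≤ 8`. [folklore] -/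
theorem abs_sub_first_le (P : DensityProfile) :
    ∃ C : ℝ, ∀ σ : ℝ, SmallDensity P σ →
      |ratioLimit P σ - 1 - (-bE 1 * ∫ y, P.β y ^ 2) * σ ^ 3| ≤ C * σ ^ 6 := by
  set K := 2 * Real.exp 1 * P.M * v₁ with hK
  set m₂ := ∫ y, P.β y ^ 2 with hm₂
  set m₃ := ∫ y, P.β y ^ 3 with hm₃
  have hK0 : 0 < K := K_pos P
  have hm₂0 : 0 ≤ m₂ := moment_nonneg P 2
  have hm₃0 : 0 ≤ m₃ := moment_nonneg P 3
  refine ⟨4 * Real.exp 1 * K ^ 3 + 12 * Real.exp 1 * |bE 1| * m₂ * K + 4 * |bE 2| * m₃, fun σ h => ?_⟩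
  have hσ0 := h.σ_pos
  have hs0 : 0 < σ ^ 3 := pow_pos hσ0 3
  have hR0 := h.ratioLimit_pos
  have hR2 := h.ratioLimit_mem.2
  have hsq := abs_sq_sub_one_le h
  have hD := abs_fixedPoint_le h
  rw [geomRatio_eq, ← hK] at hsq hD
  set R := ratioLimit P σ with hR
  have e1 : R - 1 - (-bE 1 * m₂) * σ ^ 3 =
      (R - 1 + clusterCoeff σ 1 * m₂ * R ^ 2 + clusterCoeff σ 2 * m₃ * R ^ 3) -
        σ ^ 3 * bE 1 * m₂ * (R ^ 2 - 1) - σ ^ 6 / 2 * bE 2 * m₃ * R ^ 3 := by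
    rw [clusterCoeff_one, clusterCoeff_two]; ring
  rw [e1]
  have hX : |σ ^ 3 * bE 1 * m₂ * (R ^ 2 - 1)| ≤
      σ ^ 3 * |bE 1| * m₂ * (12 * Real.exp 1 * (K * σ ^ 3)) := by
    rw [abs_mul, abs_mul, abs_mul, abs_of_pos hs0, abs_of_nonneg hm₂0]
    gcongr
  have hR3 : R ^ 3 ≤ 8 := by
    have := pow_le_pow_left₀ hR0.le hR2 3
    norm_num at this
    exact this
  have hY : |σ ^ 6 / 2 * bE 2 * m₃ * R ^ 3| ≤ σ ^ 6 / 2 * |bE 2| * m₃ * 8 := by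
    rw [abs_mul, abs_mul, abs_mul, abs_of_pos (by positivity : 0 < σ ^ 6 / 2), abs_of_nonneg hm₃0,
      abs_of_pos (pow_pos hR0 3)]
    gcongr
  have h9 : σ ^ 9 ≤ σ ^ 6 := pow_le_pow_of_le_one hσ0.le (by linarith [h.σ_lt_half]) (by norm_num)
  have hK3 : 0 ≤ 4 * Real.exp 1 * K ^ 3 := by positivity
  calc _ ≤ |R - 1 + clusterCoeff σ 1 * m₂ * R ^ 2 + clusterCoeff σ 2 * m₃ * R ^ 3| +
        |σ ^ 3 * bE 1 * m₂ * (R ^ 2 - 1)| + |σ ^ 6 / 2 * bE 2 * m₃ * R ^ 3| := by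
        refine (abs_sub _ _).trans ?_
        gcongr
        exact abs_sub _ _
    _ ≤ 4 * Real.exp 1 * (K * σ ^ 3) ^ 3 + σ ^ 3 * |bE 1| * m₂ * (12 * Real.exp 1 * (K * σ ^ 3)) +
        σ ^ 6 / 2 * |bE 2| * m₃ * 8 := by gcongr
    _ = (4 * Real.exp 1 * K ^ 3) * σ ^ 9 + (12 * Real.exp 1 * |bE 1| * m₂ * K) * σ ^ 6 +
        (4 * |bE 2| * m₃) * σ ^ 6 := by ring
    _ ≤ (4 * Real.exp 1 * K ^ 3) * σ ^ 6 + (12 * Real.exp 1 * |bE 1| * m₂ * K) * σ ^ 6 +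
        (4 * |bE 2| * m₃) * σ ^ 6 := by gcongr
    _ = _ := by ring

/-- `R² = 1 + 2 R₁ σ³ + O(σ⁶)` uniformly under `SmallDensity P σ`. [folklore] -/
theorem abs_sq_sub_first_le (P : DensityProfile) :
    ∃ C : ℝ, ∀ σ : ℝ, SmallDensity P σ →
      |ratioLimit P σ ^ 2 - 1 - 2 * (-bE 1 * ∫ y, P.β y ^ 2) * σ ^ 3| ≤ C * σ ^ 6 := by
  set K := 2 * Real.exp 1 * P.M * v₁ with hK
  set R₁ := -bE 1 * ∫ y, P.β y ^ 2 with hR₁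
  obtain ⟨A₁, hA₁⟩ := abs_sub_first_le P
  refine ⟨3 * A₁ + 4 * Real.exp 1 * |R₁| * K, fun σ h => ?_⟩
  have hσ0 := h.σ_pos
  have hs0 : 0 < σ ^ 3 := pow_pos hσ0 3
  have hR0 := h.ratioLimit_pos
  have hR2 := h.ratioLimit_mem.2
  have hE1 : |ratioLimit P σ - 1 - R₁ * σ ^ 3| ≤ A₁ * σ ^ 6 := hA₁ σ h
  have hR1 := StaticsSmoothRate.abs_ratioLimit_sub_one_le h
  rw [geomRatio_eq, ← hK] at hR1
  have hA0 : 0 ≤ A₁ * σ ^ 6 := (abs_nonneg _).trans hE1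
  set R := ratioLimit P σ with hR
  have e2 : R ^ 2 - 1 - 2 * R₁ * σ ^ 3 = (R - 1 - R₁ * σ ^ 3) * (R + 1) + R₁ * σ ^ 3 * (R - 1) := by
    ring
  rw [e2]
  have hX : |(R - 1 - R₁ * σ ^ 3) * (R + 1)| ≤ A₁ * σ ^ 6 * 3 := by
    rw [abs_mul, abs_of_pos (by linarith : 0 < R + 1)]
    exact mul_le_mul hE1 (by linarith) (by linarith) hA0
  have hY : |R₁ * σ ^ 3 * (R - 1)| ≤ |R₁| * σ ^ 3 * (4 * Real.exp 1 * (K * σ ^ 3)) := by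
    rw [abs_mul, abs_mul, abs_of_pos hs0]
    gcongr
  calc _ ≤ |(R - 1 - R₁ * σ ^ 3) * (R + 1)| + |R₁ * σ ^ 3 * (R - 1)| := abs_add_le _ _
    _ ≤ A₁ * σ ^ 6 * 3 + |R₁| * σ ^ 3 * (4 * Real.exp 1 * (K * σ ^ 3)) := add_le_add hX hY
    _ = _ := by ring

/-- **`R(σ) = 1 + R₁ σ³ + R₂ σ⁶ + O(σ⁹)`**, `R₁ = -b₁ ∫ β²`, `R₂ = 2R₁² - (b₂/2) ∫ β³`, uniformly under
`SmallDensity P σ` (insert the first-order expansions of `R²` and `R³` into the fixed-point estimate).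
[folklore] -/
theorem abs_sub_second_le (P : DensityProfile) :
    ∃ C : ℝ, ∀ σ : ℝ, SmallDensity P σ →
      |ratioLimit P σ - 1 - (-bE 1 * ∫ y, P.β y ^ 2) * σ ^ 3 -
          (2 * (-bE 1 * ∫ y, P.β y ^ 2) ^ 2 - bE 2 / 2 * ∫ y, P.β y ^ 3) * σ ^ 6| ≤ C * σ ^ 9 := by
  set K := 2 * Real.exp 1 * P.M * v₁ with hK
  set m₂ := ∫ y, P.β y ^ 2 with hm₂
  set m₃ := ∫ y, P.β y ^ 3 with hm₃
  have hm₃0 : 0 ≤ m₃ := moment_nonneg P 3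
  obtain ⟨C₂, hC₂⟩ := abs_sq_sub_first_le P
  obtain ⟨C₃, hC₃⟩ := abs_cube_sub_one_le' P
  refine ⟨4 * Real.exp 1 * K ^ 3 + |-bE 1 * m₂| * C₂ + |bE 2| / 2 * m₃ * C₃, fun σ h => ?_⟩
  have hσ0 := h.σ_pos
  have hs0 : 0 < σ ^ 3 := pow_pos hσ0 3
  have hE2 := hC₂ σ h
  have hE3 := hC₃ σ h
  have hD := abs_fixedPoint_le h
  rw [geomRatio_eq, ← hK] at hD
  set R := ratioLimit P σ with hR
  have e3 : R - 1 - (-bE 1 * m₂) * σ ^ 3 - (2 * (-bE 1 * m₂) ^ 2 - bE 2 / 2 * m₃) * σ ^ 6 =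
      (R - 1 + clusterCoeff σ 1 * m₂ * R ^ 2 + clusterCoeff σ 2 * m₃ * R ^ 3) +
        (-bE 1 * m₂) * σ ^ 3 * (R ^ 2 - 1 - 2 * (-bE 1 * m₂) * σ ^ 3) -
        σ ^ 6 * (bE 2 / 2) * m₃ * (R ^ 3 - 1) := by
    rw [clusterCoeff_one, clusterCoeff_two]; ring
  rw [e3]
  have hX : |(-bE 1 * m₂) * σ ^ 3 * (R ^ 2 - 1 - 2 * (-bE 1 * m₂) * σ ^ 3)| ≤
      |-bE 1 * m₂| * σ ^ 3 * (C₂ * σ ^ 6) := by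
    rw [abs_mul, abs_mul, abs_of_pos hs0]
    gcongr
  have hY : |σ ^ 6 * (bE 2 / 2) * m₃ * (R ^ 3 - 1)| ≤ σ ^ 6 * (|bE 2| / 2) * m₃ * (C₃ * σ ^ 3) := by
    rw [abs_mul, abs_mul, abs_mul, abs_of_pos (pow_pos hσ0 6), abs_div, abs_two,
      abs_of_nonneg hm₃0]
    gcongr
  calc _ ≤ |R - 1 + clusterCoeff σ 1 * m₂ * R ^ 2 + clusterCoeff σ 2 * m₃ * R ^ 3| +
        |(-bE 1 * m₂) * σ ^ 3 * (R ^ 2 - 1 - 2 * (-bE 1 * m₂) * σ ^ 3)| +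
        |σ ^ 6 * (bE 2 / 2) * m₃ * (R ^ 3 - 1)| := by
        refine (abs_sub _ _).trans ?_
        gcongr
        exact abs_add_le _ _
    _ ≤ 4 * Real.exp 1 * (K * σ ^ 3) ^ 3 + |-bE 1 * m₂| * σ ^ 3 * (C₂ * σ ^ 6) +
        σ ^ 6 * (|bE 2| / 2) * m₃ * (C₃ * σ ^ 3) := by gcongr
    _ = _ := by ring

/-- **Scalar second-order low-density statics** (registered helper stub `tiedStatics_ratioAsymptotics`
of the line `kidder-knob-melnikov`, serving `stub_tiedStatics`): the first cluster constant is
`b₁ = -4π/3`, and uniformly under `SmallDensity P σ` the limit insertion ratio satisfies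
`R³ = 1 + O(σ³)`, `R² = 1 + 2R₁σ³ + O(σ⁶)`, `R = 1 + R₁σ³ + R₂σ⁶ + O(σ⁹)` with `R₁ = -b₁ ∫β²`,
`R₂ = 2R₁² - (b₂/2)∫β³`. [folklore] -/
theorem tiedStatics_ratioAsymptotics :
    bE 1 = -(4 * Real.pi / 3) ∧ ∀ P : DensityProfile, ∃ C : ℝ, ∀ σ : ℝ, SmallDensity P σ →
      |ratioLimit P σ ^ 3 - 1| ≤ C * σ ^ 3 ∧
      |ratioLimit P σ ^ 2 - 1 - 2 * (-bE 1 * ∫ y, P.β y ^ 2) * σ ^ 3| ≤ C * σ ^ 6 ∧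
      |ratioLimit P σ - 1 - (-bE 1 * ∫ y, P.β y ^ 2) * σ ^ 3 -
          (2 * (-bE 1 * ∫ y, P.β y ^ 2) ^ 2 - bE 2 / 2 * ∫ y, P.β y ^ 3) * σ ^ 6| ≤ C * σ ^ 9 := by
  refine ⟨bE_one_eq, fun P => ?_⟩
  obtain ⟨C₃, hC₃⟩ := abs_cube_sub_one_le' P
  obtain ⟨C₂, hC₂⟩ := abs_sq_sub_first_le P
  obtain ⟨C₁, hC₁⟩ := abs_sub_second_le P
  refine ⟨max C₃ (max C₂ C₁), fun σ h => ?_⟩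
  have hσ := h.σ_pos.le
  refine ⟨(hC₃ σ h).trans ?_, (hC₂ σ h).trans ?_, (hC₁ σ h).trans ?_⟩
  · exact mul_le_mul_of_nonneg_right (le_max_left _ _) (pow_nonneg hσ 3)
  · exact mul_le_mul_of_nonneg_right ((le_max_left _ _).trans (le_max_right _ _)) (pow_nonneg hσ 6)
  · exact mul_le_mul_of_nonneg_right ((le_max_right _ _).trans (le_max_right _ _)) (pow_nonneg hσ 9)

end Summit.AtomisticToContinuum.HydrodynamicLimit.Theorems.TiedStaticsRatio

end
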